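import Literature.MathematicalPhysics.QuantumFieldTheory.Balaban1983to89.B9Eq326DeltaAHermitianZdCurved
import Literature.MathematicalPhysics.QuantumFieldTheory.Balaban1983to89.B9Thm311PosDefOpenZd
import Literature.MathematicalPhysics.QuantumFieldTheory.Balaban1983to89.B9Eq315QLipschitz

/-!
# `Balaban1983to89.B9Eq17RegimeBallZd` — [Balaban1985RegularSpaces] (1.7) p. 77 ∕ [Balaban1985BackgroundPropagators] Thm 3.11 p. 416: THE CLASS (1.7) ON `ℤᵈ`
# CONTAINS A UNIFORM BALL AROUND THE FLAT BACKGROUND, so «for all `U₀ ∈ 𝒰` near `1`» (the step-(ii) engine's `𝓝[𝒰] 1`-eventual conclusions) READS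
# «for every unitary `U₀` with `sup_b ‖U₀(b) − 1‖ < δ`»

statement-level skeleton of published theorems with citation tags; proofs where landed; nothing here is a claim about the
Yang–Mills mass gap

`[Balaban1985RegularSpaces]` ("B8", CMP **99** (1985) 75–102) p. 77 (1.7): the class `𝔄` of backgrounds with *«|U(∂p) − 1| < α₀L^{−2j}»* on the plaquettes of
`Ω_j`; `[Balaban1985BackgroundPropagators]` ("B9") Thm 3.11 p. 416 is stated *«for U satisfying (3.35)»*, a small-field class of the same shape, and its
perturbative use around `U = 1` (p. 416) is over ALL backgrounds whose bond variables are uniformly close to `1` — a uniform ball, not a product-topology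
neighbourhood.  PDF held: `paper:balaban1985-cmp99-background-propagators` p. 416; B8 p. 77.

WHY THIS FILE (cell `pub-ymgap`, HUMAN RULING D-0062 ∕ D-0149; seat `pub-ymgap-dag-n06-w2` (g3), node N06 = [B9]; CLAIM-3; count-neutral).  dag-n06-w4 g3's step-(ii)
engine (`B9Thm311PosDefOpenZd`) concludes `∀ᶠ U₀ in 𝓝[𝒰] 1, …` for a background set `𝒰 ∋ 1` and extracts from it (`exists_delta_of_eventually_nhdsWithin`) «every
`U₀ ∈ 𝒰` δ-close to `1` at every bond»; this seat's `B9Eq326DeltaAHermitianZdCurved` supplies the engine's structural inputs on `𝒰 := {U₀ unitary, (1.7) on Ω ≡ ℤᵈ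
up to level m at window α_Q}` (and on `𝒰′`, window `α_Q∕L²`).  Those sets are NOT open in the product topology (the (1.7) clause binds every plaquette), so the
residual clause «`U₀ ∈ 𝒰`» must be discharged separately: it IS, because a unitary configuration whose bond variables are `ε`-close to `1` has all plaquette
variables `4ε`-close to `1` (four-bond telescoping, `B9Eq315QLipschitz.norm_hol_sub_one_le`), hence lies in `𝒰` once `4ε < α_Q L^{−2m}`.

WHAT IS PROVED (kernel, 0 sorry; proof lane — no `def`).
* §1 `norm_plaqF_sub_one_le` (`‖U(∂p) − 1‖ ≤ 4ε` for a `U1`-valued configuration with bond variables `ε`-close to `1`) · `inv_sq_pow_anti` ·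
  ★ `reg17Univ_of_bond_close` (`4ε < αL^{−2m}` ⟹ `Reg17 L m (Ω ≡ ℤᵈ) α U₀`) · `reg17_of_bond_close` (any domain sequence `Ω`).
* §2 ★★ `ball_subset_reg17Univ` ∕ `ball_subset_reg17UnivP` — the uniform balls of radii `δ` with `4δ < α_Q L^{−2m}` (resp. `4δ < (α_Q∕L²)L^{−2m}`) of unitary
  configurations around `1` lie in `𝒰` (resp. `𝒰′`) · `expCfg_iEta_mem_reg17Univ` (A6-richness: `e^{iηA} ∈ 𝒰` for every Hermitian field with `4η‖A‖_∞ < α_Q L^{−2m}`).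
* §3 ★★★ `exists_uniform_ball_of_eventually_reg17Univ` ∕ ★★★ `exists_uniform_ball_of_eventually_reg17UnivP` — «`∀ᶠ U₀ in 𝓝[𝒰] 1, P U₀`» ⟹ «`∃ δ > 0`, every
  unitary `U₀` with `‖U₀(b) − 1‖ < δ` at every bond satisfies `P`» (dag-n06-w4's `exists_delta_of_eventually_nhdsWithin` + §2).
HONEST SCOPE.  Topology and four-bond telescoping; no estimate of [B9]; Thm 3.11 at curved `U₀` NOT proved here (the engine's letter-continuity hypothesis is
dag-n06-w4 g3's files 4–6); count-neutral helper of K1⁷; N05∕N06 NOT discharged; one finite lattice programme at fixed `ε`; R4 closes the conditional finite-𝕋⁴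
rung `BalabanLadder.UV` only; nothing continuum ∕ ℝ⁴ ∕ OS ∕ mass-gap ∕ Clay.  Unit `pub-ymgap-dag-n06-w2` (g3), 2026-08-28.
-/

noncomputable section

open scoped Topology
open Filter

namespace Literature.MathematicalPhysics.QuantumFieldTheory.Balaban1983to89.B9Eq17RegimeBallZd

open B7Prop1Explicit (U1 plaqWord)
open B7Prop2Explicit (unitaryUnits unitaryUnits_le_U1)
open B7Prop3Flat (expCfg)
open B8Ineq132 (plaqF PlaqTouches)
open B8Eq146AExpansion (iEta)
open B8Eq155JBound (expCfg_iEta_mem_unitaryUnits norm_expCfg_iEta_sub_one_le)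
open B9Eq316AveragingTransposeZd (Reg17 alphaQ alphaQ_pos)

-- `Site` alone could resolve to the torus sites of `Setup.lean`; re-export the `ℤ^d` sites of `B7Prop1Explicit`.
export B7Prop1Explicit (Site)

variable {d : ℕ} {𝔸 : Type*} [CStarAlgebra 𝔸]

/-! ## §1 Plaquette variables of a configuration with near-identity bond variables -/

section Plaquettes

variable [Nontrivial 𝔸]

/-- **`‖U(∂p) − 1‖ ≤ 4ε`** for a `U1`-valued configuration whose bond variables are `ε`-close to `1`: the plaquette variable is the holonomy of a four-bond word
(`B9Eq315QLipschitz.norm_hol_sub_one_le`, telescoping). [cite: Balaban1985RegularSpaces, (1.7) p.77; Balaban1985Averaging, (9) p.18] -/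
theorem norm_plaqF_sub_one_le {V : Site d → Fin d → 𝔸ˣ} (hV : ∀ x κ, V x κ ∈ U1 𝔸) {ε : ℝ} (hU : ∀ x κ, ‖(V x κ : 𝔸) - 1‖ ≤ ε)
    (μ ν : Fin d) (x : Site d) : ‖plaqF V μ ν x - 1‖ ≤ 4 * ε := by
  have h := B9Eq315QLipschitz.norm_hol_sub_one_le hV hU x (plaqWord μ ν)
  have hl : ((plaqWord μ ν).length : ℝ) = 4 := by simp [plaqWord]
  rw [hl] at h
  exact h

omit [CStarAlgebra 𝔸] [Nontrivial 𝔸] in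
/-- `(L^j)⁻² ≥ (L^m)⁻²` for `j ≤ m`, `L ≥ 1` (the level-`m` plaquette clause of (1.7) is the strongest). [cite: Balaban1985RegularSpaces, (1.7) p.77] -/
theorem inv_sq_pow_anti {L : ℕ} (hL : 1 ≤ L) {j m : ℕ} (hj : j ≤ m) :
    (((L : ℝ) ^ m)⁻¹) ^ 2 ≤ (((L : ℝ) ^ j)⁻¹) ^ 2 := by
  have hL' : (1 : ℝ) ≤ L := by exact_mod_cast hL
  have hj0 : (0 : ℝ) < (L : ℝ) ^ j := by positivity
  have hpow : (L : ℝ) ^ j ≤ (L : ℝ) ^ m := pow_le_pow_right₀ hL' hj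
  have hinv : ((L : ℝ) ^ m)⁻¹ ≤ ((L : ℝ) ^ j)⁻¹ := inv_anti₀ hj0 hpow
  exact pow_le_pow_left₀ (by positivity) hinv 2

/-- ★ **NEAR-FLAT UNITARY CONFIGURATIONS ARE IN THE CLASS (1.7) ON ALL OF `ℤᵈ`**: if every bond variable of a `U1`-valued `U₀` is `ε`-close to `1` and
`4ε < α·L^{−2m}`, then `|U₀(∂p) − 1| < αL^{−2j}` for EVERY plaquette `p` and every `j ≤ m` (`Reg17 L m (Ω ≡ ℤᵈ) α U₀`; `L ≥ 1`).
[cite: Balaban1985RegularSpaces, (1.7) p.77] -/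
theorem reg17Univ_of_bond_close {L : ℕ} (hL : 1 ≤ L) (m : ℕ) {α ε : ℝ} {U₀ : Site d → Fin d → 𝔸ˣ} (hV : ∀ x κ, U₀ x κ ∈ U1 𝔸)
    (hU : ∀ x κ, ‖(U₀ x κ : 𝔸) - 1‖ ≤ ε) (hε : 4 * ε < α * (((L : ℝ) ^ m)⁻¹) ^ 2) :
    Reg17 L m (fun _ => (Set.univ : Set (Site d))) α U₀ := by
  intro j hj x μ ν _ _
  have hε0 : 0 ≤ ε := (norm_nonneg _).trans (hU x μ)
  have hm0 : (0 : ℝ) < (((L : ℝ) ^ m)⁻¹) ^ 2 := by positivity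
  have hα : 0 < α := by
    have h4 : (0 : ℝ) < α * (((L : ℝ) ^ m)⁻¹) ^ 2 := lt_of_le_of_lt (by positivity) hε
    exact pos_of_mul_pos_left h4 hm0.le
  exact (norm_plaqF_sub_one_le hV hU μ ν x).trans_lt (hε.trans_le (mul_le_mul_of_nonneg_left (inv_sq_pow_anti hL hj) hα.le))

/-- the same for ANY domain sequence `Ω` (the univ clause is the strongest). [cite: Balaban1985RegularSpaces, (1.7) p.77] -/
theorem reg17_of_bond_close {L : ℕ} (hL : 1 ≤ L) (m : ℕ) (Ω : ℕ → Set (Site d)) {α ε : ℝ} {U₀ : Site d → Fin d → 𝔸ˣ}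
    (hV : ∀ x κ, U₀ x κ ∈ U1 𝔸) (hU : ∀ x κ, ‖(U₀ x κ : 𝔸) - 1‖ ≤ ε) (hε : 4 * ε < α * (((L : ℝ) ^ m)⁻¹) ^ 2) :
    Reg17 L m Ω α U₀ :=
  fun j hj x μ ν hμν _ => reg17Univ_of_bond_close hL m hV hU hε j hj x μ ν hμν (Or.inl (Set.mem_univ x))

end Plaquettes

/-! ## §2 The uniform ball around the flat background lies in the regime sets `𝒰`, `𝒰′` -/

section Ball

variable [Nontrivial 𝔸]

/-- ★★ **THE UNIFORM `δ`-BALL OF UNITARY CONFIGURATIONS AROUND `1` LIES IN `𝒰`** (`𝒰 = {U₀ unitary, (1.7) on ℤᵈ up to level m at window α_Q}`, the regime set of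
`B9Eq326DeltaAHermitianZdCurved.linear_herm_on_reg17Univ`) whenever `4δ < α_Q L^{−2m}` (`L ≥ 1`). [cite: Balaban1985RegularSpaces, (1.7) p.77; Balaban1985BackgroundPropagators, Thm 3.11 p.416] -/
theorem ball_subset_reg17Univ {L : ℕ} (hL : 1 ≤ L) (m : ℕ) {δ : ℝ} (hδ : 4 * δ < alphaQ d L * (((L : ℝ) ^ m)⁻¹) ^ 2) :
    {U₀ : Site d → Fin d → 𝔸ˣ | (∀ x κ, U₀ x κ ∈ unitaryUnits 𝔸) ∧ ∀ x κ, ‖(U₀ x κ : 𝔸) - 1‖ < δ} ⊆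
      {U₀ : Site d → Fin d → 𝔸ˣ | (∀ x κ, U₀ x κ ∈ unitaryUnits 𝔸) ∧ Reg17 L m (fun _ => (Set.univ : Set (Site d))) (alphaQ d L) U₀} :=
  fun _ hU => ⟨hU.1, reg17Univ_of_bond_close hL m (fun x κ => unitaryUnits_le_U1 (hU.1 x κ)) (fun x κ => (hU.2 x κ).le) hδ⟩

/-- ★★ **THE SAME FOR `𝒰′`** (window `α_Q∕L²`, dag-n06-w3 g3's regime set ∕ the letter's own guard on `ℤᵈ`): `4δ < (α_Q∕L²)L^{−2m}` suffices.
[cite: Balaban1985RegularSpaces, (1.7) p.77] -/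
theorem ball_subset_reg17UnivP {L : ℕ} (hL : 1 ≤ L) (m : ℕ) {δ : ℝ} (hδ : 4 * δ < alphaQ d L / (L : ℝ) ^ 2 * (((L : ℝ) ^ m)⁻¹) ^ 2) :
    {U₀ : Site d → Fin d → 𝔸ˣ | (∀ x κ, U₀ x κ ∈ unitaryUnits 𝔸) ∧ ∀ x κ, ‖(U₀ x κ : 𝔸) - 1‖ < δ} ⊆
      {U₀ : Site d → Fin d → 𝔸ˣ | (∀ x κ, U₀ x κ ∈ unitaryUnits 𝔸) ∧ Reg17 L m (fun _ => (Set.univ : Set (Site d))) (alphaQ d L / (L : ℝ) ^ 2) U₀} :=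
  fun _ hU => ⟨hU.1, reg17Univ_of_bond_close hL m (fun x κ => unitaryUnits_le_U1 (hU.1 x κ)) (fun x κ => (hU.2 x κ).le) hδ⟩

/-- **A6-RICHNESS OF THE REGIME SET**: for every HERMITIAN (𝔤-valued) bounded field `A` and `η ≥ 0` with `4η‖A‖_∞ < α_Q L^{−2m}`, the background `e^{iηA}` (B8's (1.41)
variable) is unitary-valued and lies in `𝒰` — the regime set contains every small perturbation of the flat background in print's sense, not just `U₀ = 1`.
[cite: Balaban1985RegularSpaces, (1.7) p.77, (1.41) p.83; Balaban1985BackgroundPropagators, Thm 3.11 p.416] -/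
theorem expCfg_iEta_mem_reg17Univ {L : ℕ} (hL : 1 ≤ L) (m : ℕ) {η : ℝ} (hη : 0 ≤ η) {A : Site d → Fin d → 𝔸}
    (hA : ∀ y κ, IsSelfAdjoint (A y κ)) {a : ℝ} (hAb : ∀ y κ, ‖A y κ‖ ≤ a) (hsmall : 4 * (η * a) < alphaQ d L * (((L : ℝ) ^ m)⁻¹) ^ 2) :
    expCfg (iEta η A) ∈ {U₀ : Site d → Fin d → 𝔸ˣ | (∀ x κ, U₀ x κ ∈ unitaryUnits 𝔸) ∧
        Reg17 L m (fun _ => (Set.univ : Set (Site d))) (alphaQ d L) U₀} := by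
  have hu : ∀ x κ, expCfg (iEta η A) x κ ∈ unitaryUnits 𝔸 := expCfg_iEta_mem_unitaryUnits η hA
  refine ⟨hu, reg17Univ_of_bond_close hL m (fun x κ => unitaryUnits_le_U1 (hu x κ)) (fun x κ => ?_) hsmall⟩
  exact (norm_expCfg_iEta_sub_one_le hη hA x κ).trans (mul_le_mul_of_nonneg_left (hAb x κ) hη)

end Ball

/-! ## §3 «For all `U₀ ∈ 𝒰` near `1`» is a uniform-ball statement -/

section Uniform

variable [Nontrivial 𝔸]

omit [Nontrivial 𝔸] in
/-- the bond variables of the flat background are `1`. [cite: Balaban1985RegularSpaces, (1.7) p.77 (U = 1)] -/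
private theorem one_apply_val (y : Site d) (μ : Fin d) : (((1 : Site d → Fin d → 𝔸ˣ) y μ : 𝔸ˣ) : 𝔸) = 1 := by
  rw [Pi.one_apply, Pi.one_apply, Units.val_one]

/-- ★★★ **A `𝓝[𝒰] 1`-EVENTUAL PROPERTY HOLDS ON A UNIFORM BALL OF UNITARY BACKGROUNDS**: if `P U₀` holds for all `U₀ ∈ 𝒰` near the flat background (the conclusion
shape of dag-n06-w4's step-(ii) engine on this seat's regime set `𝒰`, window `α_Q`), then there is `δ > 0` such that `P U₀` holds for EVERY unitary-valued `U₀` with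
`‖U₀(b) − 1‖ < δ` at every bond `b` — print's perturbative reading of Theorem 3.11 around `U = 1`.  (`exists_delta_of_eventually_nhdsWithin` gives `δ₁` and the residual
clause `U₀ ∈ 𝒰`; §2 discharges it for `δ ≤ α_Q L^{−2m}∕5`.) [cite: Balaban1985BackgroundPropagators, Thm 3.11 p.416; Balaban1985RegularSpaces, (1.7) p.77] -/
theorem exists_uniform_ball_of_eventually_reg17Univ {L : ℕ} (hL : 1 ≤ L) (m : ℕ) {P : (Site d → Fin d → 𝔸ˣ) → Prop}
    (h : ∀ᶠ U₀ in 𝓝[{U₀ : Site d → Fin d → 𝔸ˣ | (∀ x κ, U₀ x κ ∈ unitaryUnits 𝔸) ∧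
        Reg17 L m (fun _ => (Set.univ : Set (Site d))) (alphaQ d L) U₀}] (1 : Site d → Fin d → 𝔸ˣ), P U₀) :
    ∃ δ : ℝ, 0 < δ ∧ ∀ U₀ : Site d → Fin d → 𝔸ˣ, (∀ x κ, U₀ x κ ∈ unitaryUnits 𝔸) →
      (∀ x κ, ‖(U₀ x κ : 𝔸) - 1‖ < δ) → P U₀ := by
  obtain ⟨δ₁, hδ₁, hP⟩ := B9Thm311PosDefOpenZd.exists_delta_of_eventually_nhdsWithin h
  have hL0 : (0 : ℝ) < L := by exact_mod_cast hL
  set δ₂ : ℝ := alphaQ d L * (((L : ℝ) ^ m)⁻¹) ^ 2 / 5 with hδ₂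
  have hδ₂pos : 0 < δ₂ := by have := alphaQ_pos d hL; positivity
  have hδ₂lt : 4 * δ₂ < alphaQ d L * (((L : ℝ) ^ m)⁻¹) ^ 2 := by
    have := alphaQ_pos d hL
    have hq : (0 : ℝ) < alphaQ d L * (((L : ℝ) ^ m)⁻¹) ^ 2 := by positivity
    rw [hδ₂]; linarith
  refine ⟨min δ₁ δ₂, lt_min hδ₁ hδ₂pos, fun U₀ hU hclose => hP U₀ ?_ fun y μ => ?_⟩
  · exact ball_subset_reg17Univ hL m hδ₂lt ⟨hU, fun x κ => (hclose x κ).trans_le (min_le_right _ _)⟩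
  · rw [one_apply_val]
    exact (hclose y μ).trans_le (min_le_left _ _)

/-- ★★★ **THE SAME ON `𝒰′`** (window `α_Q∕L²`). [cite: Balaban1985BackgroundPropagators, Thm 3.11 p.416; Balaban1985RegularSpaces, (1.7) p.77] -/
theorem exists_uniform_ball_of_eventually_reg17UnivP {L : ℕ} (hL : 1 ≤ L) (m : ℕ) {P : (Site d → Fin d → 𝔸ˣ) → Prop}
    (h : ∀ᶠ U₀ in 𝓝[{U₀ : Site d → Fin d → 𝔸ˣ | (∀ x κ, U₀ x κ ∈ unitaryUnits 𝔸) ∧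
        Reg17 L m (fun _ => (Set.univ : Set (Site d))) (alphaQ d L / (L : ℝ) ^ 2) U₀}] (1 : Site d → Fin d → 𝔸ˣ), P U₀) :
    ∃ δ : ℝ, 0 < δ ∧ ∀ U₀ : Site d → Fin d → 𝔸ˣ, (∀ x κ, U₀ x κ ∈ unitaryUnits 𝔸) →
      (∀ x κ, ‖(U₀ x κ : 𝔸) - 1‖ < δ) → P U₀ := by
  obtain ⟨δ₁, hδ₁, hP⟩ := B9Thm311PosDefOpenZd.exists_delta_of_eventually_nhdsWithin h
  have hL0 : (0 : ℝ) < L := by exact_mod_cast hL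
  set δ₂ : ℝ := alphaQ d L / (L : ℝ) ^ 2 * (((L : ℝ) ^ m)⁻¹) ^ 2 / 5 with hδ₂
  have hδ₂pos : 0 < δ₂ := by have := alphaQ_pos d hL; positivity
  have hδ₂lt : 4 * δ₂ < alphaQ d L / (L : ℝ) ^ 2 * (((L : ℝ) ^ m)⁻¹) ^ 2 := by
    have := alphaQ_pos d hL
    have hq : (0 : ℝ) < alphaQ d L / (L : ℝ) ^ 2 * (((L : ℝ) ^ m)⁻¹) ^ 2 := by positivity
    rw [hδ₂]; linarith
  refine ⟨min δ₁ δ₂, lt_min hδ₁ hδ₂pos, fun U₀ hU hclose => hP U₀ ?_ fun y μ => ?_⟩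
  · exact ball_subset_reg17UnivP hL m hδ₂lt ⟨hU, fun x κ => (hclose x κ).trans_le (min_le_right _ _)⟩
  · rw [one_apply_val]
    exact (hclose y μ).trans_le (min_le_left _ _)

/-- **conversely, the uniform-ball conclusion is the natural one**: a uniform ball of unitary configurations is NOT contained in any `𝓝 1`-neighbourhood
statement's complement — recorded here only as the trivial direction «uniform ball ⟹ `U₀ ∈ 𝒰` and bondwise close on every finite set», i.e. the hypotheses of
`B9Thm311PosDefOpenZd.exists_finset_ball_of_eventually_nhdsWithin`'s conclusion are met by every member of the ball. [cite: Balaban1985RegularSpaces, (1.7) p.77] -/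
theorem ball_mem_and_close {L : ℕ} (hL : 1 ≤ L) (m : ℕ) {δ : ℝ} (hδ : 4 * δ < alphaQ d L * (((L : ℝ) ^ m)⁻¹) ^ 2)
    {U₀ : Site d → Fin d → 𝔸ˣ} (hU : ∀ x κ, U₀ x κ ∈ unitaryUnits 𝔸) (hclose : ∀ x κ, ‖(U₀ x κ : 𝔸) - 1‖ < δ) (F : Finset (Site d)) :
    U₀ ∈ {U₀ : Site d → Fin d → 𝔸ˣ | (∀ x κ, U₀ x κ ∈ unitaryUnits 𝔸) ∧ Reg17 L m (fun _ => (Set.univ : Set (Site d))) (alphaQ d L) U₀} ∧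
      ∀ y ∈ F, ∀ μ : Fin d, ‖(U₀ y μ : 𝔸) - (1 : Site d → Fin d → 𝔸ˣ) y μ‖ < δ :=
  ⟨ball_subset_reg17Univ hL m hδ ⟨hU, hclose⟩, fun y _ μ => by rw [one_apply_val]; exact hclose y μ⟩

end Uniform

end Literature.MathematicalPhysics.QuantumFieldTheory.Balaban1983to89.B9Eq17RegimeBallZd

end
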